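/-
Copyright: lit-balaban cell, Phase-2 proof seat p02 (gen 8).  Statement-level skeleton of a published paper; no proof claims beyond what
the kernel checks below.
-/
import Literature.MathematicalPhysics.QuantumFieldTheory.BalabanImbrieJaffe1984to88.BIJ88Ineq555W3CorrMechanism
import Literature.MathematicalPhysics.QuantumFieldTheory.BalabanImbrieJaffe1984to88.BIJ88Sect2SigmaAllTori
import Literature.MathematicalPhysics.QuantumFieldTheory.BalabanImbrieJaffe1984to88.BIJ85Prop12AllTori
import Literature.MathematicalPhysics.QuantumFieldTheory.BalabanImbrieJaffe1984to88.BIJ88Sect5StatementsPart2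

/-!
# `BalabanImbrieJaffe1984to88.BIJ88W1HkPart544Torus` — T. Bałaban, J. Imbrie, A. Jaffe, *Effective action and cluster properties of the
abelian Higgs model*, Commun. Math. Phys. **114** (1988) 257–315 [BalabanImbrieJaffe1988]: p. 282 [PDF 26], **THE `H`-PART `H_k□ − H_{k,loc}` OF
THE KERNEL `w₁ = w′₁ + H_k□ − H_{k,loc}` OF (5.4.4) ON THE TORI OF THE SERIES, FOR THE KERNELS OF RECORD** — *"We have put
w₁ = w′₁ + H_k□ − H_{k,loc}, and it satisfies the same bounds as w′₁"*, the bounds being those displayed for `w′₁`: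
`|(∂w′₁)(p,b′)| ≦ … ≦ e^{−cr(e_k)}e^{−c dist(p,b′)}` *"and similarly for w′₁, ∂*w′₁ … we use w′₁(b,b′) only for b in □₀ ⊂ □"*.  PROVED here for
the `H`-part `K = H_k□ − H_{k,loc}` on the rows `b ∈ □₀` (as the print uses it): the entry bound `|K(b,b′)| ≤ e^{−cr}e^{−c dist(b,b′)}` and the
η-curl bound `|(∂^ηK)(p,b′)| ≤ e^{−cr}e^{−c dist(p,b′)}` — r16's typed shape `BIJ88Sect5StatementsPart2.Ineq547` — with ONE `c > 0` and ONE
radius threshold for EVERY torus (`P.d = d`, `P.L = L`) and EVERY `k ≤ m + K`, HYPOTHESIS-FREE (the `|H|` and `|∇H|` members of (I.7.2.2)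
over all tori; [6I] Prop. 1.2 by name DISCHARGED by p19's `prop12Printed_allTori`).  `H_k` = p11's `HkE` kernel, `H_{k,loc} = ζ_kH_k` (2.4) with
p13's constructed (2.1) cutoff; the `w′₁`-part (the (2.12) tails `𝒟_k − 𝒟_{k,loc}`) is p08's lane (`BIJ88OpCloseDkLocTorus`, in flight) and
NOT treated; the `∂*` member is left to a successor.

statement-level skeleton of published theorems with citation tags; proofs where landed; nothing here is a claim about the Yang–Mills mass gap

PDF held: `paper:balaban1988-cmp114-bij-abelian-higgs-effective-action` (journal p. = PDF p. + 256); p. 282 [PDF 26] read as an image (r16 render p026).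

CITATION HEADER (lean-in-tree rule).  Part of the lit-balaban TYPED SKELETON (HOME `run/shared/lean/pub/lit-balaban/`), Phase-2 proof seat
p02 (gen 8), unit `lit-balaban-p02-g8`; WHAT IS REPRODUCED = member «w₁ satisfies the same bounds as w′₁» (its `H`-part) of SKELETON row
**C2.Eq5.4.7** (owner r16, referee ref-5; r16's list 21:31:33Z item (1): `w′₁`, `∂w′₁`, `∂*w′₁`, `w₁` as torus theorems), kind «model instance
for the kernels of record, all-tori hypothesis-free shape».  Decls of record used BY NAME (nothing restated): this seat's
`BIJ88Ineq555W3CorrMechanism.bracket_eq_mul`/`abs_curl_mul_le`/`abs_distEU_sub_le_of_supDist_le_one`/`exists_lipschitz_cutoffProfile`/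
`lip_cutoff_torus` (p306809); r18 g10's `BIJ88Sect2SigmaAllTori.exists_gradB_allTori_of_prop12Printed`; p16/p19's
`BIJ85Sect72AllTori.exists_absH_le_allTori_of_prop12Printed`/`abs_H_zero_le`, `BIJ85Prop12AllTori.prop12Printed_allTori`; p08 g7's
`BIJ88Ineq217Ineq722Torus.curl_HkE_single_eq`, `BIJ88HkLocTorus.ofLp_HkE_single_bond`; p13's `cutoff`/`isCutoff_cutoff`/`cutoff_mem_Icc`; r18's
`loc`/`IsCutoff`; r16's `Ineq547`.  TAKING line HOME/STATUS.md (gen 8, seventh file).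

THE PRINTED TEXT (p. 282 [PDF 26], read as an image, verbatim): *"The kernel w′₁ = (𝒟_k − 𝒟_{k,loc})∂*Q^{e*}_k∂□ involves only the tails not
included in the expansion (2.12). Using the regularity and exponential decay of H_j, H_{j,loc}, along with (2.7) and scaling properties of these
kernels, we find that |(∂w′₁)(p,b′)| ≦ Σ_{j=1}^{k−1}(L^jη)^{−1−(d−2)−1+(d−2)}e^{−cr(e_j)}e^{−c dist(p,b′)} ≦ e^{−cr(e_k)}e^{−c dist(p,b′)}, and similarly for
w′₁, ∂*w′₁. Also, w′₁ is finite ranged in the sense that w′₁ = w′₁□; we use w′₁(b,b′) only for b in □₀ ⊂ □. … (Q^{s*}_k − 𝒟_{k,loc}∂*Q^{e*}_k∂)□A′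
= (H_k + ∂C_k)□A′ + w′₁A′ = H_{k,loc}A′ + ∂C_k□A′ + w₁A′. (5.4.4) We have put w₁ = w′₁ + H_k□ − H_{k,loc}, and it satisfies the same bounds as
w′₁."*

THE READING.  `K(b, b′) := H_k(b,b′)χ□(b′) − H_{k,loc}(b,b′) = (χ□(b′) − ζ_k(b,b′))·H_k(b,b′)` (`b` an η-bond, `b′` a unit bond of `T₁^{(k)}`;
`□` a contraction `|χ□| ≤ 1` on unit bonds); the rows are restricted by a weight `χ₀` on fine sites (`|χ₀| ≤ 1`, `□₀ = {χ₀ ≠ 0}`), and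
`□₀ ⊂ □` with its collar is typed as the clause `χ₀(x) ≠ 0 ⟹ dist(x, b′) ≤ r/8 + 2 ⟹ χ□(b′) = 1` (print p. 281: □ is □₀ enlarged by `2r(e_k)`).
THE MECHANISM: on a row in `□₀`, at `b′ ∈ □` the entry is `(1 − ζ_k)H_k`, supported at `dist ≥ r/16` where `|H_k| ≤ Me^{−δ dist} ≤
Me^{−(δ/2)(r/16)}e^{−(δ/2)dist}`; at `b′ ∉ □` the clause gives `dist > r/8`, so `ζ_k = 0` and the entry is `χ□(b′)H_k`, again far.  The η-curl:
discrete Leibniz (p306809) — the main term `(χ□ − ζ_k(b₁))·∂^ηH_k(·,b′)` by the GRADIENT member of (I.7.2.2) (no `η⁻¹` loss), the three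
remainder terms `η⁻¹(ζ_k(b₁) − ζ_k(b_i))H_k(b_i,b′)` by the `η⁻¹`-Lipschitz constant of the (2.1) cutoff, all supported at `dist ≥ r/16 − 1`.

WHAT IS PROVED (0 `sorry`, standard axioms; theorems only — proof lane):
* §1 generic (any column family `H` with `|H(b,b′)| ≤ Me^{−δ dist}` and `|∂^ηH(·,b′)(q)| ≤ 2Me^{−δ dist(q₋,b′)}`, any (2.1)-cutoff `0 ≤ ζ ≤ 1` with
  `η⁻¹`-Lipschitz constant `K`, any `|χ□| ≤ 1`, `χ₀` with the collar clause): `abs_hkPart_le` (`|K(b,b′)| ≤ Me^{−(δ/2)(r/16)}e^{−(δ/2)dist(b,b′)}` on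
  rows `χ₀(b₋) ≠ 0`), `rem_term_le_decay`, **`abs_curl_hkPart_le`** (`|∂^ηK(·,b′)(q)| ≤ (2 + 3Ke^δ)Me^{−(δ/2)(r/16)}e^{−(δ/2)dist(q₋,b′)}` for `χ₀(q₋) ≠ 0`).
* §2 ON THE TORI FOR THE KERNELS OF RECORD, ALL TORI, HYPOTHESIS-FREE: **`ineq547_w1HkPart_allTori`** — `∃ c > 0, r₁` such that for EVERY
  torus (`P.d = d`, `P.L = L`), EVERY `k ≤ m + K`, every `c′ ≠ 0`, `w > 0`, `r ≥ r₁`, `|χ□| ≤ 1`, `|χ₀| ≤ 1` with the collar clause: r16's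
  `Ineq547 (PBond P 0) (PBond P k) (χ₀(b₋)·K) dist c r` AND `Ineq547 (TPlaq P 0) (PBond P k) (χ₀(q₋)·∂^ηK) dist c r` (`c = δ/64`).
HONEST SCOPE.  (i) Only the `H`-part of `w₁`, entry and `∂` members; `w′₁` is NOT treated; `∂*` is the sibling `BIJ88W1HkPart544DivTorus`.
(ii) `□₀ ⊂ □` typed by the collar clause; `□`, `□₀` as contractions/weights; `1 ≤ d`, `L` odd `> 1`, `a > 0` only.  (iii) Constants explicit;
`U = 1` real abelian fields; standing range; no `def`, no new named fact; NOT summit progress.  Unit `lit-balaban-p02-g8`, 2026-08-21.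
-/

open scoped BigOperators RealInnerProductSpace

namespace Literature.MathematicalPhysics.QuantumFieldTheory.BalabanImbrieJaffe1984to88.BIJ88W1HkPart544Torus

open Balaban1983to89 hiding Site Plaq
open Balaban1983to89.LatticeFieldCalculus
open Balaban1983to89.B3TorusRadialSums (supDist_eq_zero_iff)
open BIJ85Prop521Torus BIJ85Sigma421Torus BIJ85Prop522Torus
open BIJ85Sect7Statements BIJ85Ineq722Torus
open BIJ85Ineq722DeltaA (deltaAData)
open BIJ88Sect2Statements (loc IsCutoff)
open BIJ88Sect5StatementsPart2 (Ineq547)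
open BIJ88Cutoffs21 (cutoff isCutoff_cutoff cutoff_mem_Icc)
open BIJ88Ineq217Ineq722Torus (curl_HkE_single_eq)
open BIJ88HkLocTorus (ofLp_HkE_single_bond)
open BIJ85Sect72AllTori (exists_absH_le_allTori_of_prop12Printed abs_H_zero_le)
open BIJ85Prop12AllTori (prop12Printed_allTori)
open BIJ88Sect2SigmaAllTori (exists_gradB_allTori_of_prop12Printed)
open BIJ88Ineq555W3CorrMechanism (bracket_eq_mul abs_curl_mul_le abs_distEU_sub_le_of_supDist_le_one
  exists_lipschitz_cutoffProfile lip_cutoff_torus)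

open Balaban1983to89 renaming Site → TSite, Plaq → TPlaq

noncomputable section

variable {P : Params}

/-! ## §0  Plumbing -/

/-- `|x − (x + e_μ)|_∞ ≤ 1`. [folklore] -/
private theorem supDist_shift_le {j : ℕ} (x : TSite P j) (μ : Fin P.d) : supDist x (x.shift μ) ≤ 1 := by
  have h := supDist_runSite_le x μ 1
  have h2 : runSite x μ 1 = x.shift μ := by
    show Function.update x μ (x μ + ((1 : ℕ) : ZMod _)) = Function.update x μ (x μ + 1)
    rw [Nat.cast_one]
  rwa [h2] at h

/-- `1/L^k ≤ 1`. [folklore] -/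
private theorem one_div_pow_L_le_one (k : ℕ) : 1 / (P.L : ℝ) ^ k ≤ 1 := by
  have hL1 : (1 : ℝ) ≤ (P.L : ℝ) := by exact_mod_cast P.L_pos
  rw [div_le_one (by positivity)]
  exact one_le_pow₀ hL1

/-- `0 ≤ dist(x, y)`. [folklore] -/
private theorem distEU_nonneg' (k : ℕ) (x : TSite P 0) (y : TSite P k) : 0 ≤ distEU P k x y :=
  div_nonneg (Nat.cast_nonneg _) (pow_nonneg (Nat.cast_nonneg _) _)

/-- splitting the decay: `e^{−δt} ≤ e^{−(δ/2)s}e^{−(δ/2)u}` whenever `s ≤ t` and `u ≤ t` (`δ ≥ 0`). [folklore] -/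
private theorem exp_split {δ t s u : ℝ} (hδ : 0 ≤ δ) (hs : s ≤ t) (hu : u ≤ t) :
    Real.exp (-(δ * t)) ≤ Real.exp (-(δ / 2 * s)) * Real.exp (-(δ / 2 * u)) := by
  rw [← Real.exp_add]
  exact Real.exp_le_exp.2 (by nlinarith)

/-! ## §1  The `H`-part `K = H_k□ − H_{k,loc}` on the rows of `□₀`: entry and η-curl -/

/-- **`|K(b,b′)| ≤ Me^{−(δ/2)(r/16)}e^{−(δ/2)dist(b,b′)}` on the rows of `□₀`** for `K(b,b′) = H(b,b′)χ□(b′) − (ζH)(b,b′)`: at `b′ ∈ □` the entry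
`(1 − ζ)H` lives at `dist ≥ r/16`, at `b′ ∉ □` the collar clause puts `b′` beyond `r/8` where `ζ = 0`. [cite: BalabanImbrieJaffe1988, (5.4.4) p.282] -/
theorem abs_hkPart_le {k : ℕ} {H : PBond P k → VecField P 0 ℝ} {δ M : ℝ} (hδ : 0 ≤ δ) (hM : 0 ≤ M)
    (hH : ∀ b' b, |H b' b| ≤ M * Real.exp (-(δ * distEU P k b.src b'.src)))
    {r : ℝ} (hr : 0 < r) {ζ : PBond P 0 → PBond P k → ℝ}
    (hcut : IsCutoff (fun (b : PBond P 0) (b' : PBond P k) => distEU P k b.src b'.src) ζ (r / 16) (r / 8))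
    (h01 : ∀ b b', 0 ≤ ζ b b' ∧ ζ b b' ≤ 1)
    {χb : PBond P k → ℝ} (hχb : ∀ b', |χb b'| ≤ 1) {χ₀ : TSite P 0 → ℝ}
    (hbox : ∀ (x : TSite P 0) (b' : PBond P k), χ₀ x ≠ 0 → distEU P k x b'.src ≤ r / 8 + 2 → χb b' = 1)
    {b : PBond P 0} (hb : χ₀ b.src ≠ 0) (b' : PBond P k) :
    |H b' b * χb b' - loc ζ (fun b b'' => H b'' b) b b'| ≤
      M * Real.exp (-(δ / 2 * (r / 16))) * Real.exp (-(δ / 2 * distEU P k b.src b'.src)) := by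
  have e : H b' b * χb b' - loc ζ (fun b b'' => H b'' b) b b' = (χb b' - ζ b b') * H b' b := by
    simp only [loc]; ring
  rw [e, abs_mul]
  have hHb := hH b' b
  -- in both cases the entry lives at `dist ≥ r/16` and the first factor is `≤ 1`
  have key : ∀ {f : ℝ}, |f| ≤ 1 → (f = 0 ∨ r / 16 ≤ distEU P k b.src b'.src) →
      |f| * |H b' b| ≤ M * Real.exp (-(δ / 2 * (r / 16))) * Real.exp (-(δ / 2 * distEU P k b.src b'.src)) := by
    intro f hf hor
    rcases hor with h0 | hfar
    · rw [h0, abs_zero, zero_mul]; positivity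
    · calc |f| * |H b' b| ≤ 1 * (M * Real.exp (-(δ * distEU P k b.src b'.src))) := mul_le_mul hf hHb (abs_nonneg _) zero_le_one
        _ ≤ M * (Real.exp (-(δ / 2 * (r / 16))) * Real.exp (-(δ / 2 * distEU P k b.src b'.src))) := by
            rw [one_mul]; exact mul_le_mul_of_nonneg_left (exp_split hδ hfar le_rfl) hM
        _ = _ := by ring
  by_cases h1 : χb b' = 1
  · refine key ?_ ?_
    · rw [h1, abs_le]; constructor <;> linarith [(h01 b b').1, (h01 b b').2]
    · by_cases hle : distEU P k b.src b'.src ≤ r / 16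
      · left; rw [h1, hcut.1 b b' hle, sub_self]
      · right; exact (not_le.1 hle).le
  · have hfar : r / 8 + 2 < distEU P k b.src b'.src := by
      by_contra hcon
      exact h1 (hbox b.src b' hb (not_lt.1 hcon))
    have hz : ζ b b' = 0 := hcut.2 b b' (by show r / 8 ≤ distEU P k b.src b'.src; linarith)
    rw [hz, sub_zero]
    exact key (hχb b') (Or.inr (by linarith))

/-- **one Leibniz remainder term WITH ITS DECAY**: for adjacent fine sites `x, x′`, an `η⁻¹`-Lipschitz (2.1)-cutoff and
`|g| ≤ Me^{−δ dist(x′,b′)}`: `η⁻¹|ζ(⟨x,λ⟩,b′) − ζ(⟨x′,λ′⟩,b′)|·|g| ≤ KMe^{δ}·e^{−(δ/2)(r/16)}·e^{−(δ/2)dist(x,b′)}` (the difference vanishes unless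
`dist(x′, b′) > r/16 − 1`, and `|dist(x′,b′) − dist(x,b′)| ≤ 1`). [cite: BalabanImbrieJaffe1988, (5.4.4) p.282] -/
theorem rem_term_le_decay {k : ℕ} {δ M K r : ℝ} (hδ : 0 ≤ δ) (hM : 0 ≤ M) (hK : 0 ≤ K) {ζ : PBond P 0 → PBond P k → ℝ}
    (hcut : IsCutoff (fun (b : PBond P 0) (b' : PBond P k) => distEU P k b.src b'.src) ζ (r / 16) (r / 8))
    {x x' : TSite P 0} {lam lam' : Fin P.d} {b' : PBond P k}
    (hLip : (P.L : ℝ) ^ k * |ζ ⟨x, lam⟩ b' - ζ ⟨x', lam'⟩ b'| ≤ K) (hxx' : supDist x x' ≤ 1) {g : ℝ}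
    (hg : |g| ≤ M * Real.exp (-(δ * distEU P k x' b'.src))) :
    (P.L : ℝ) ^ k * |ζ ⟨x, lam⟩ b' - ζ ⟨x', lam'⟩ b'| * |g| ≤
      K * M * Real.exp δ * Real.exp (-(δ / 2 * (r / 16))) * Real.exp (-(δ / 2 * distEU P k x b'.src)) := by
  by_cases hin : distEU P k x b'.src ≤ r / 16 ∧ distEU P k x' b'.src ≤ r / 16
  · rw [hcut.1 ⟨x, lam⟩ b' hin.1, hcut.1 ⟨x', lam'⟩ b' hin.2, sub_self, abs_zero, mul_zero, zero_mul]
    positivity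
  · have hD := abs_distEU_sub_le_of_supDist_le_one hxx' b'.src
    have h3 := one_div_pow_L_le_one (P := P) k
    rw [abs_le] at hD
    have hfar : r / 16 - 1 < distEU P k x' b'.src := by
      by_contra hcon
      rw [not_lt] at hcon
      exact hin ⟨by linarith, by linarith⟩
    have hnear : distEU P k x b'.src - 1 ≤ distEU P k x' b'.src := by linarith
    have hg' : |g| ≤ M * (Real.exp δ * Real.exp (-(δ / 2 * (r / 16))) * Real.exp (-(δ / 2 * distEU P k x b'.src))) := by
      refine hg.trans (mul_le_mul_of_nonneg_left ?_ hM)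
      rw [← Real.exp_add, ← Real.exp_add]
      refine Real.exp_le_exp.2 ?_
      have h5 := mul_le_mul_of_nonneg_left hfar.le (by positivity : (0 : ℝ) ≤ δ / 2)
      have h6 := mul_le_mul_of_nonneg_left hnear (by positivity : (0 : ℝ) ≤ δ / 2)
      linarith
    calc (P.L : ℝ) ^ k * |ζ ⟨x, lam⟩ b' - ζ ⟨x', lam'⟩ b'| * |g| ≤ K * |g| := mul_le_mul_of_nonneg_right hLip (abs_nonneg g)
      _ ≤ K * (M * (Real.exp δ * Real.exp (-(δ / 2 * (r / 16))) * Real.exp (-(δ / 2 * distEU P k x b'.src)))) :=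
          mul_le_mul_of_nonneg_left hg' hK
      _ = _ := by ring

/-- **`|(∂^ηK)(q, b′)| ≤ (2 + 3Ke^δ)·M·e^{−(δ/2)(r/16)}·e^{−(δ/2)dist(q₋,b′)}` on the plaquettes of `□₀`** — *"|(∂w′₁)(p,b′)| ≦ … e^{−cr(e_k)}e^{−c dist(p,b′)}
… and it [w₁] satisfies the same bounds"*, the `H`-part: discrete Leibniz for `∂^η((χ□(b′) − ζ_k)H_k(·,b′))`, main term by the gradient member
of (I.7.2.2) (`|∂^ηH(·,b′)(q)| ≤ 2Me^{−δ dist}`), remainders by `rem_term_le_decay`; off `□` the collar clause kills `ζ_k` on the bonds of `q`.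
[cite: BalabanImbrieJaffe1988, (5.4.4) p.282] -/
theorem abs_curl_hkPart_le {k : ℕ} {H : PBond P k → VecField P 0 ℝ} {δ M : ℝ} (hδ : 0 ≤ δ) (hM : 0 ≤ M)
    (hH : ∀ b' b, |H b' b| ≤ M * Real.exp (-(δ * distEU P k b.src b'.src)))
    (hcurl : ∀ b' q, |curl ((P.L : ℝ) ^ k) (H b') q| ≤ 2 * M * Real.exp (-(δ * distEU P k q.src b'.src)))
    {r K : ℝ} (hr : 0 < r) (hK : 0 ≤ K) {ζ : PBond P 0 → PBond P k → ℝ}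
    (hcut : IsCutoff (fun (b : PBond P 0) (b' : PBond P k) => distEU P k b.src b'.src) ζ (r / 16) (r / 8))
    (h01 : ∀ b b', 0 ≤ ζ b b' ∧ ζ b b' ≤ 1)
    (hLipζ : ∀ (x x' : TSite P 0) (lam lam' : Fin P.d) (b' : PBond P k), supDist x x' ≤ 1 →
      (P.L : ℝ) ^ k * |ζ ⟨x, lam⟩ b' - ζ ⟨x', lam'⟩ b'| ≤ K)
    {χb : PBond P k → ℝ} (hχb : ∀ b', |χb b'| ≤ 1) {χ₀ : TSite P 0 → ℝ}
    (hbox : ∀ (x : TSite P 0) (b' : PBond P k), χ₀ x ≠ 0 → distEU P k x b'.src ≤ r / 8 + 2 → χb b' = 1)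
    {q : TPlaq P 0} (hq : χ₀ q.src ≠ 0) (b' : PBond P k) :
    |curl ((P.L : ℝ) ^ k) (fun b => H b' b * χb b' - loc ζ (fun b b'' => H b'' b) b b') q| ≤
      (2 + 3 * K * Real.exp δ) * M * Real.exp (-(δ / 2 * (r / 16))) * Real.exp (-(δ / 2 * distEU P k q.src b'.src)) := by
  have hL : (0 : ℝ) < (P.L : ℝ) ^ k := by have := P.L_pos; positivity
  rw [bracket_eq_mul ζ H (χb b') b']
  have main := abs_curl_mul_le ((P.L : ℝ) ^ k) (fun b => χb b' - ζ b b') (H b') q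
  beta_reduce at main
  have hsub : ∀ b₁ b₂ : PBond P 0, (χb b' - ζ b₂ b') - (χb b' - ζ b₁ b') = ζ b₁ b' - ζ b₂ b' := fun _ _ => by ring
  rw [hsub, hsub, hsub, abs_of_pos hL] at main
  have hs0 : supDist q.src q.src ≤ 1 := by rw [(supDist_eq_zero_iff _ _).2 rfl]; exact zero_le_one
  have hs1 : supDist q.src (q.src.shift q.μ) ≤ 1 := supDist_shift_le _ _
  have hs2 : supDist q.src (q.src.shift q.ν) ≤ 1 := supDist_shift_le _ _
  have T2 := rem_term_le_decay hδ hM hK hcut (hLipζ _ _ q.μ q.ν b' hs1) hs1 (hH b' ⟨q.src.shift q.μ, q.ν⟩)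
  have T3 := rem_term_le_decay hδ hM hK hcut (hLipζ _ _ q.μ q.μ b' hs2) hs2 (hH b' ⟨q.src.shift q.ν, q.μ⟩)
  have T4 := rem_term_le_decay hδ hM hK hcut (hLipζ _ _ q.μ q.ν b' hs0) hs0 (hH b' ⟨q.src, q.ν⟩)
  set E := Real.exp (-(δ / 2 * (r / 16))) * Real.exp (-(δ / 2 * distEU P k q.src b'.src)) with hE
  -- the main term
  have T1 : |χb b' - ζ ⟨q.src, q.μ⟩ b'| * |curl ((P.L : ℝ) ^ k) (H b') q| ≤ 2 * M * E := by
    have key : ∀ {f : ℝ}, |f| ≤ 1 → (f = 0 ∨ r / 16 ≤ distEU P k q.src b'.src) →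
        |f| * |curl ((P.L : ℝ) ^ k) (H b') q| ≤ 2 * M * E := by
      intro f hf hor
      rcases hor with h0 | hfar
      · rw [h0, abs_zero, zero_mul]; positivity
      · calc |f| * |curl ((P.L : ℝ) ^ k) (H b') q| ≤ 1 * (2 * M * Real.exp (-(δ * distEU P k q.src b'.src))) :=
              mul_le_mul hf (hcurl b' q) (abs_nonneg _) zero_le_one
          _ ≤ 2 * M * E := by
              rw [one_mul, hE]; exact mul_le_mul_of_nonneg_left (exp_split hδ hfar le_rfl) (by positivity)
    by_cases h1 : χb b' = 1
    · refine key ?_ ?_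
      · rw [h1, abs_le]; constructor <;> linarith [(h01 ⟨q.src, q.μ⟩ b').1, (h01 ⟨q.src, q.μ⟩ b').2]
      · by_cases hle : distEU P k q.src b'.src ≤ r / 16
        · left; rw [h1, hcut.1 ⟨q.src, q.μ⟩ b' hle, sub_self]
        · right; exact (not_le.1 hle).le
    · have hfar : r / 8 + 2 < distEU P k q.src b'.src := by
        by_contra hcon
        exact h1 (hbox q.src b' hq (not_lt.1 hcon))
      have hz : ζ ⟨q.src, q.μ⟩ b' = 0 := hcut.2 ⟨q.src, q.μ⟩ b' (by show r / 8 ≤ distEU P k q.src b'.src; linarith)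
      rw [hz, sub_zero]
      exact key (hχb b') (Or.inr (by linarith))
  refine main.trans ?_
  have e3 : (2 + 3 * K * Real.exp δ) * M * Real.exp (-(δ / 2 * (r / 16))) * Real.exp (-(δ / 2 * distEU P k q.src b'.src)) =
      2 * M * E + (K * M * Real.exp δ * Real.exp (-(δ / 2 * (r / 16))) * Real.exp (-(δ / 2 * distEU P k q.src b'.src)) +
        K * M * Real.exp δ * Real.exp (-(δ / 2 * (r / 16))) * Real.exp (-(δ / 2 * distEU P k q.src b'.src)) +
        K * M * Real.exp δ * Real.exp (-(δ / 2 * (r / 16))) * Real.exp (-(δ / 2 * distEU P k q.src b'.src))) := by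
    rw [hE]; ring
  rw [e3, mul_add, mul_add]
  refine add_le_add T1 (add_le_add (add_le_add ?_ ?_) ?_)
  · rw [← mul_assoc]; exact T2
  · rw [← mul_assoc]; exact T3
  · rw [← mul_assoc]; exact T4

/-! ## §2  On the tori for the kernels of record, all tori, hypothesis-free -/

/-- `A ≤ γt ⟹ Ae^{−2γt} ≤ e^{−γt}`. [folklore] -/
private theorem small_of_le_mul {A γ t : ℝ} (h : A ≤ γ * t) : A * Real.exp (-(2 * γ * t)) ≤ Real.exp (-(γ * t)) := by
  have h1 : A ≤ Real.exp (γ * t) := h.trans (by linarith [Real.add_one_le_exp (γ * t)])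
  have e : Real.exp (-(2 * γ * t)) = Real.exp (-(γ * t)) * Real.exp (-(γ * t)) := by rw [← Real.exp_add]; ring_nf
  rw [e, ← mul_assoc]
  have h2 : A * Real.exp (-(γ * t)) ≤ 1 := by
    have h3 := mul_le_mul_of_nonneg_right h1 (Real.exp_pos (-(γ * t))).le
    rwa [← Real.exp_add, show γ * t + -(γ * t) = 0 by ring, Real.exp_zero] at h3
  calc A * Real.exp (-(γ * t)) * Real.exp (-(γ * t)) ≤ 1 * Real.exp (-(γ * t)) :=
        mul_le_mul_of_nonneg_right h2 (Real.exp_pos _).le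
    _ = _ := one_mul _

/-- **THE `H`-PART OF `w₁` ON THE TORI OF THE SERIES, ALL TORI, HYPOTHESIS-FREE** (`1 ≤ d`, `L` odd `> 1`, `a > 0`): ONE `c > 0` and ONE threshold
`r₁` such that for EVERY torus `P` (`P.d = d`, `P.L = L`), EVERY `k ≤ m + K`, every `c′ ≠ 0`, `w > 0` (parameters of p11's `HkE`), every
`r ≥ r₁`, every cube contraction `|χ□| ≤ 1` and row weight `|χ₀| ≤ 1` with the collar clause `χ₀(x) ≠ 0 ⟹ dist(x,b′) ≤ r/8 + 2 ⟹ χ□(b′) = 1`: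
r16's `Ineq547 (PBond P 0) (PBond P k) (χ₀(b₋)·K) dist c r` AND `Ineq547 (TPlaq P 0) (PBond P k) (χ₀(q₋)·∂^ηK) dist c r` for
`K = H_k□ − H_{k,loc}`, `H_k` = p11's `HkE` kernel, `H_{k,loc} = ζ_kH_k` with p13's (2.1) cutoff `cutoff (r/16) (r/8) dist` — *"it satisfies the
same bounds as w′₁"* (entry and `∂` members), `c = δ/64`, `δ = min(δ_H, δ_∇)` of the all-tori (I.7.2.2) members. [cite: BalabanImbrieJaffe1988, (5.4.4) p.282] -/
theorem ineq547_w1HkPart_allTori {d L : ℕ} (hd : 1 ≤ d) (hL : Odd L ∧ 1 < L) {a : ℝ} (ha : 0 < a) :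
    ∃ c r₁ : ℝ, 0 < c ∧ ∀ (P : Params) (_ : P.d = d) (_ : P.L = L) (k : ℕ) (_ : k ≤ P.m + P.K) (c' : ℝ), c' ≠ 0 →
      ∀ (w : ℝ), 0 < w → ∀ (r : ℝ), r₁ ≤ r → ∀ (χb : PBond P k → ℝ), (∀ b', |χb b'| ≤ 1) →
      ∀ (χ₀ : TSite P 0 → ℝ), (∀ x, |χ₀ x| ≤ 1) →
      (∀ (x : TSite P 0) (b' : PBond P k), χ₀ x ≠ 0 → distEU P k x b'.src ≤ r / 8 + 2 → χb b' = 1) →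
        Ineq547 (PBond P 0) (PBond P k)
            (fun b b' => χ₀ b.src *
              (WithLp.ofLp (HkE P w c' k (toEj P k (Pi.single b' 1))) b * χb b' -
                loc (cutoff (r / 16) (r / 8) (fun (b : PBond P 0) (b' : PBond P k) => distEU P k b.src b'.src))
                  (fun b b'' => WithLp.ofLp (HkE P w c' k (toEj P k (Pi.single b'' 1))) b) b b'))
            (fun b b' => distEU P k b.src b'.src) c r ∧
          Ineq547 (TPlaq P 0) (PBond P k)
            (fun q b' => χ₀ q.src *
              curl ((P.L : ℝ) ^ k) (fun b =>
                WithLp.ofLp (HkE P w c' k (toEj P k (Pi.single b' 1))) b * χb b' -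
                  loc (cutoff (r / 16) (r / 8) (fun (b : PBond P 0) (b' : PBond P k) => distEU P k b.src b'.src))
                    (fun b b'' => WithLp.ofLp (HkE P w c' k (toEj P k (Pi.single b'' 1))) b) b b') q)
            (fun q b' => distEU P k q.src b'.src) c r := by
  have h12 := prop12Printed_allTori d L ha
  obtain ⟨δg, Mg, hδg, hMg, hG⟩ := exists_gradB_allTori_of_prop12Printed hd hL ha h12
  obtain ⟨δh, Mh, hδh, hMh, hH1⟩ := exists_absH_le_allTori_of_prop12Printed hd hL ha h12
  obtain ⟨C, hC, hLip₀⟩ := exists_lipschitz_cutoffProfile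
  set δ := min δg δh with hδdef
  set M := max Mg Mh with hMdef
  have hδ : 0 < δ := lt_min hδg hδh
  have hM1 : 1 ≤ M := hMh.trans (le_max_right _ _)
  have hM0 : 0 ≤ M := zero_le_one.trans hM1
  set A := (2 + 3 * C * Real.exp δ) * M with hAdef
  have hA : 0 ≤ A := by positivity
  have hMA : M ≤ A := by
    have : (1 : ℝ) ≤ 2 + 3 * C * Real.exp δ := by nlinarith [Real.exp_pos δ, hC.le]
    nlinarith
  refine ⟨δ / 64, max 16 (64 * A / δ), by positivity, ?_⟩
  intro P hPd hPL k hk c' hc' w hw r hr χb hχb χ₀ hχ₀ hbox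
  have hr16 : 16 ≤ r := (le_max_left _ _).trans hr
  have hrA : 64 * A / δ ≤ r := (le_max_right _ _).trans hr
  have hr0 : 0 < r := by linarith
  have hAr : A ≤ δ / 64 * r := by rw [div_le_iff₀ hδ] at hrA; linarith
  have hexp : ∀ {δ₁ : ℝ} {t : ℝ}, δ ≤ δ₁ → 0 ≤ t → Real.exp (-(δ₁ * t)) ≤ Real.exp (-(δ * t)) := fun h ht =>
    Real.exp_le_exp.2 (by nlinarith)
  -- the `|H|` member at this torus and scale (scale 0: `H₀ = I`)
  have hH : ∀ (b' : PBond P k) (b : PBond P 0),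
      |WithLp.ofLp (HkE P w c' k (toEj P k (Pi.single b' 1))) b| ≤ M * Real.exp (-(δ * distEU P k b.src b'.src)) := by
    intro b' b
    rw [ofLp_HkE_single_bond hk hc' hw ha b b']
    rcases Nat.eq_zero_or_pos k with hk0 | hk1
    · subst hk0
      exact abs_H_zero_le hk ha hM1 δ b.dir b'.dir b.src b'.src
    · calc |(torusRep P k (deltaAData hk a)).H (b.src, b.dir) (b'.src, b'.dir)|
          ≤ Mh * Real.exp (-(δh * distEU P k b.src b'.src)) := hH1 P hPd hPL k hk1 hk b.dir b'.dir b.src b'.src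
        _ ≤ M * Real.exp (-(δ * distEU P k b.src b'.src)) :=
            mul_le_mul (le_max_right _ _) (hexp (min_le_right _ _) (distEU_nonneg' k _ _)) (Real.exp_pos _).le hM0
  -- the gradient member: the η-curl of the column
  have hcurl : ∀ (b' : PBond P k) (q : TPlaq P 0),
      |curl ((P.L : ℝ) ^ k) (WithLp.ofLp (HkE P w c' k (toEj P k (Pi.single b' 1)))) q| ≤
        2 * M * Real.exp (-(δ * distEU P k q.src b'.src)) := by
    intro b' q
    rw [curl_HkE_single_eq hk hc' hw ha ((P.L : ℝ) ^ k) b' q]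
    have hcomp : ∀ (ν' lam : Fin P.d),
        |(P.L : ℝ) ^ k * ((torusRep P k (deltaAData hk a)).H (q.src.shift lam, ν') (b'.src, b'.dir) -
            (torusRep P k (deltaAData hk a)).H (q.src, ν') (b'.src, b'.dir))| ≤ M * Real.exp (-(δ * distEU P k q.src b'.src)) := by
      intro ν' lam
      have h1 := norm_le_pi_norm (fun lam : Fin P.d => (P.L : ℝ) ^ k *
        ((torusRep P k (deltaAData hk a)).H (q.src.shift lam, ν') (b'.src, b'.dir) -
          (torusRep P k (deltaAData hk a)).H (q.src, ν') (b'.src, b'.dir))) lam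
      rw [Real.norm_eq_abs] at h1
      refine h1.trans ((hG P hPd hPL k hk ν' b'.dir q.src b'.src).trans ?_)
      exact mul_le_mul (le_max_left _ _) (hexp (min_le_left _ _) (distEU_nonneg' k _ _)) (Real.exp_pos _).le hM0
    have h2 := hcomp q.ν q.μ
    have h3 := hcomp q.μ q.ν
    refine (abs_sub _ _).trans ?_
    linarith
  have hcut := isCutoff_cutoff (show r / 16 < r / 8 by linarith) (fun (b : PBond P 0) (b' : PBond P k) => distEU P k b.src b'.src)
  have h01 := cutoff_mem_Icc (r / 16) (r / 8) (fun (b : PBond P 0) (b' : PBond P k) => distEU P k b.src b'.src)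
  have hLipζ : ∀ (x x' : TSite P 0) (lam lam' : Fin P.d) (b' : PBond P k), supDist x x' ≤ 1 →
      (P.L : ℝ) ^ k * |cutoff (r / 16) (r / 8) (fun (b : PBond P 0) (b' : PBond P k) => distEU P k b.src b'.src) ⟨x, lam⟩ b' -
        cutoff (r / 16) (r / 8) (fun (b : PBond P 0) (b' : PBond P k) => distEU P k b.src b'.src) ⟨x', lam'⟩ b'| ≤ C :=
    fun x x' lam lam' b' hxx' => lip_cutoff_torus hC.le hr16 (hLip₀ (r / 16) (r / 8) (by linarith)) x x' lam lam' b' hxx'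
  -- the smallness `Ae^{−(δ/32)r} ≤ e^{−(δ/64)r}` and the weaker decay rate `δ/2 ↦ δ/64`
  have hsmall : A * Real.exp (-(δ / 2 * (r / 16))) ≤ Real.exp (-(δ / 64 * r)) := by
    have h := small_of_le_mul hAr
    have e : -(2 * (δ / 64) * r) = -(δ / 2 * (r / 16)) := by ring
    rwa [e] at h
  have hdecay : ∀ {t : ℝ}, 0 ≤ t → Real.exp (-(δ / 2 * t)) ≤ Real.exp (-(δ / 64 * t)) := fun ht =>
    Real.exp_le_exp.2 (by nlinarith)
  refine ⟨fun b b' => ?_, fun q b' => ?_⟩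
  · -- the entry member
    rw [abs_mul]
    by_cases hb : χ₀ b.src = 0
    · rw [hb, abs_zero, zero_mul]; positivity
    · have h := abs_hkPart_le (H := fun b' => WithLp.ofLp (HkE P w c' k (toEj P k (Pi.single b' 1)))) hδ.le hM0 hH hr0 hcut h01
        hχb hbox hb b'
      calc |χ₀ b.src| * |WithLp.ofLp (HkE P w c' k (toEj P k (Pi.single b' 1))) b * χb b' -
              loc (cutoff (r / 16) (r / 8) (fun (b : PBond P 0) (b' : PBond P k) => distEU P k b.src b'.src))
                (fun b b'' => WithLp.ofLp (HkE P w c' k (toEj P k (Pi.single b'' 1))) b) b b'|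
          ≤ 1 * (M * Real.exp (-(δ / 2 * (r / 16))) * Real.exp (-(δ / 2 * distEU P k b.src b'.src))) :=
            mul_le_mul (hχ₀ b.src) h (abs_nonneg _) zero_le_one
        _ ≤ A * Real.exp (-(δ / 2 * (r / 16))) * Real.exp (-(δ / 64 * distEU P k b.src b'.src)) := by
            rw [one_mul]
            exact mul_le_mul (mul_le_mul_of_nonneg_right hMA (Real.exp_pos _).le) (hdecay (distEU_nonneg' k _ _))
              (Real.exp_pos _).le (by positivity)
        _ ≤ Real.exp (-(δ / 64 * r)) * Real.exp (-(δ / 64 * distEU P k b.src b'.src)) :=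
            mul_le_mul_of_nonneg_right hsmall (Real.exp_pos _).le
  · -- the `∂` member
    rw [abs_mul]
    by_cases hq : χ₀ q.src = 0
    · rw [hq, abs_zero, zero_mul]; positivity
    · have h := abs_curl_hkPart_le (H := fun b' => WithLp.ofLp (HkE P w c' k (toEj P k (Pi.single b' 1)))) hδ.le hM0 hH hcurl hr0
        hC.le hcut h01 hLipζ hχb hbox hq b'
      calc |χ₀ q.src| * |curl ((P.L : ℝ) ^ k) (fun b =>
              WithLp.ofLp (HkE P w c' k (toEj P k (Pi.single b' 1))) b * χb b' -
                loc (cutoff (r / 16) (r / 8) (fun (b : PBond P 0) (b' : PBond P k) => distEU P k b.src b'.src))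
                  (fun b b'' => WithLp.ofLp (HkE P w c' k (toEj P k (Pi.single b'' 1))) b) b b') q|
          ≤ 1 * (A * Real.exp (-(δ / 2 * (r / 16))) * Real.exp (-(δ / 2 * distEU P k q.src b'.src))) :=
            mul_le_mul (hχ₀ q.src) h (abs_nonneg _) zero_le_one
        _ ≤ A * Real.exp (-(δ / 2 * (r / 16))) * Real.exp (-(δ / 64 * distEU P k q.src b'.src)) := by
            rw [one_mul]
            exact mul_le_mul_of_nonneg_left (hdecay (distEU_nonneg' k _ _)) (by positivity)
        _ ≤ Real.exp (-(δ / 64 * r)) * Real.exp (-(δ / 64 * distEU P k q.src b'.src)) :=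
            mul_le_mul_of_nonneg_right hsmall (Real.exp_pos _).le

end

end Literature.MathematicalPhysics.QuantumFieldTheory.BalabanImbrieJaffe1984to88.BIJ88W1HkPart544Torus
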